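import Mathlib
import HarnessLib

/-!
# SquareWellLayerCake · `AveragedTwelve` — the ghost frame (stub `stub_ghostFrame`)

Stub `stub_ghostFrame` of line `Sketch` (idea `par-five-delaunay-recount`) of crux
`SquareWellLayerCake.AveragedTwelve` (item stmt-AtomisticToContinuum-15806), route
`AtomisticToContinuum/Crystallization/SquareWellLayerCake`.

GHOST FRAME: every finite point set `P ⊆ ℝ³` lies in the interior of the convex hull of
`P ∪ Γ` for a finite set `Γ` of six extra points, all farther than any prescribed `R` from `P`.

## Proof

Put `M := ∑_{p ∈ P} ‖p‖` (so `‖p‖ ≤ M` on `P`) and `L := 3M + |R| + 3`, and let `Γ` be the six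
vertices `± L • eᵢ` of a big octahedron (`eᵢ = EuclideanSpace.single i 1`).

* Distances: `‖± L • eᵢ‖ = L`, so `dist g p ≥ ‖g‖ - ‖p‖ ≥ L - M > R` for `g ∈ Γ`, `p ∈ P`.
* Interior: the open ball `B(0, M + 1)` is contained in every convex set `S` containing the six
  vertices (here `S = conv (P ∪ Γ)`): `0 ∈ S` as the midpoint of `± L • e₀`; for `‖x‖ < M + 1`
  one has `|xᵢ| ≤ ‖x‖` (`PiLp.norm_apply_le`), so `3 xᵢ • eᵢ = (3|xᵢ|/L) • (± L • eᵢ)` with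
  `3|xᵢ|/L ∈ [0, 1]` lies in `S`, and `x = ∑ᵢ (1/3) • (3 xᵢ • eᵢ)` is a convex combination of
  three points of `S`.  An open subset of `conv (P ∪ Γ)` lies in its interior, and
  `P ⊆ B(0, M + 1)`.

Mathlib only; no named facts.
-/

noncomputable section

namespace Summit.AtomisticToContinuum.Crystallization.Theorems.ParFiveRecountGhostFrame

open Metric

/-- Expansion of a vector of `ℝ³` along the standard basis: `x = ∑ᵢ xᵢ • eᵢ`.
[folklore] -/
theorem sum_apply_smul_single (x : EuclideanSpace ℝ (Fin 3)) :
    ∑ i, x i • EuclideanSpace.single i (1 : ℝ) = x := by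
  simpa using (EuclideanSpace.basisFun (Fin 3) ℝ).sum_repr x

/-- The vertices `c • eᵢ` of the frame have norm `|c|`. [folklore] -/
theorem norm_smul_single (c : ℝ) (i : Fin 3) :
    ‖c • EuclideanSpace.single i (1 : ℝ)‖ = |c| := by
  simp [norm_smul]

/-- A point of norm `L` is farther than `R` from every point of norm at most `M`, provided
`R < L - M`. [folklore] -/
theorem lt_dist_of_norm_eq {g p : EuclideanSpace ℝ (Fin 3)} {L M R : ℝ} (hg : ‖g‖ = L)
    (hp : ‖p‖ ≤ M) (hR : R < L - M) : R < dist g p := by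
  rw [dist_eq_norm]
  have h := norm_sub_norm_le g p
  linarith

/-- The open ball `B(0, M + 1)` is contained in every convex set containing the six octahedron
vertices `± L • eᵢ`, as soon as `3 (M + 1) ≤ L` and `0 < L`. [folklore] -/
theorem ball_subset_of_convex (S : Set (EuclideanSpace ℝ (Fin 3))) (hS : Convex ℝ S) {M L : ℝ}
    (hL : 3 * (M + 1) ≤ L) (hL0 : 0 < L)
    (hplus : ∀ i : Fin 3, L • EuclideanSpace.single i (1 : ℝ) ∈ S)
    (hminus : ∀ i : Fin 3, (-L) • EuclideanSpace.single i (1 : ℝ) ∈ S) :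
    ball (0 : EuclideanSpace ℝ (Fin 3)) (M + 1) ⊆ S := by
  intro x hx
  rw [mem_ball_zero_iff] at hx
  -- the origin is the midpoint of `± L • e₀`
  have h0 : (0 : EuclideanSpace ℝ (Fin 3)) ∈ S := by
    have hmid := hS (hplus 0) (hminus 0) (by norm_num : (0 : ℝ) ≤ 1 / 2)
      (by norm_num : (0 : ℝ) ≤ 1 / 2) (by norm_num)
    have h : (1 / 2 : ℝ) • (L • EuclideanSpace.single (0 : Fin 3) (1 : ℝ)) +
        (1 / 2 : ℝ) • ((-L) • EuclideanSpace.single (0 : Fin 3) (1 : ℝ)) = 0 := by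
      rw [smul_smul, smul_smul, ← add_smul]
      have : (1 / 2 : ℝ) * L + 1 / 2 * -L = 0 := by ring
      rw [this, zero_smul]
    rwa [h] at hmid
  -- each tripled coordinate component lies in `S`
  have hcoord : ∀ i : Fin 3, (3 * x i) • EuclideanSpace.single i (1 : ℝ) ∈ S := by
    intro i
    have hxi : |x i| ≤ ‖x‖ := by
      have h := PiLp.norm_apply_le x i
      rwa [Real.norm_eq_abs] at h
    have h3 : 3 * |x i| ≤ L := by linarith
    rcases le_total 0 (x i) with hnn | hnp
    · have habs : |x i| = x i := abs_of_nonneg hnn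
      rw [habs] at h3
      have hmem := hS.smul_mem_of_zero_mem h0 (hplus i) (t := 3 * x i / L)
        ⟨by positivity, by rw [div_le_one hL0]; linarith⟩
      rw [smul_smul] at hmem
      convert hmem using 2
      field_simp
    · have habs : |x i| = -x i := abs_of_nonpos hnp
      rw [habs] at h3
      have hmem := hS.smul_mem_of_zero_mem h0 (hminus i) (t := -(3 * x i) / L)
        ⟨by apply div_nonneg <;> linarith, by rw [div_le_one hL0]; linarith⟩
      rw [smul_smul] at hmem
      convert hmem using 2
      field_simp
  -- `x` is the barycentre of the three components
  have hsum : ∑ i, (1 / 3 : ℝ) • ((3 * x i) • EuclideanSpace.single i (1 : ℝ)) = x := by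
    simp_rw [smul_smul]
    have h : ∀ i : Fin 3, (1 / 3 : ℝ) * (3 * x i) = x i := fun i => by ring
    simp_rw [h]
    exact sum_apply_smul_single x
  rw [← hsum]
  refine hS.sum_mem (fun _ _ => by norm_num) ?_ (fun i _ => hcoord i)
  simp only [Finset.sum_const, Finset.card_univ, Fintype.card_fin, nsmul_eq_mul]
  norm_num

/-- **Ghost frame** (stub `stub_ghostFrame` of line `Sketch`, crux
`SquareWellLayerCake.AveragedTwelve`).  Every finite point set `P ⊆ ℝ³` lies in the interior of
the convex hull of `P ∪ Γ` for some finite `Γ` (the six vertices `± L • eᵢ` of a large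
octahedron) all of whose points are farther than `R` from every point of `P`. [folklore] -/
theorem stub_ghostFrame : ∀ (P : Finset (EuclideanSpace ℝ (Fin 3))) (R : ℝ), ∃ Γ : Finset (EuclideanSpace ℝ (Fin 3)), (∀ g ∈ Γ, ∀ p ∈ P, R < dist g p) ∧ ((↑P : Set (EuclideanSpace ℝ (Fin 3))) ⊆ interior (convexHull ℝ (↑(P ∪ Γ) : Set (EuclideanSpace ℝ (Fin 3))))) := by
  intro P R
  -- a common bound on the norms of the points of `P`
  set M : ℝ := ∑ p ∈ P, ‖p‖ with hM
  have hPM : ∀ p ∈ P, ‖p‖ ≤ M := fun p hp =>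
    Finset.single_le_sum (f := fun q : EuclideanSpace ℝ (Fin 3) => ‖q‖)
      (fun q _ => norm_nonneg q) hp
  have hM0 : 0 ≤ M := Finset.sum_nonneg fun p _ => norm_nonneg p
  -- the size of the frame
  set L : ℝ := 3 * M + |R| + 3 with hL
  have hRabs : R ≤ |R| := le_abs_self R
  have hRabs0 : 0 ≤ |R| := abs_nonneg R
  have hL0 : 0 < L := by linarith
  have hL3 : 3 * (M + 1) ≤ L := by linarith
  have hLR : R < L - M := by linarith
  -- the frame: six octahedron vertices, packaged by their properties
  obtain ⟨Γ, hplus, hminus, hnorm⟩ : ∃ Γ : Finset (EuclideanSpace ℝ (Fin 3)),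
      (∀ i : Fin 3, L • EuclideanSpace.single i (1 : ℝ) ∈ Γ) ∧
      (∀ i : Fin 3, (-L) • EuclideanSpace.single i (1 : ℝ) ∈ Γ) ∧
      (∀ g ∈ Γ, ‖g‖ = L) := by
    refine ⟨(Finset.univ.image fun i : Fin 3 => L • EuclideanSpace.single i (1 : ℝ)) ∪
        (Finset.univ.image fun i : Fin 3 => (-L) • EuclideanSpace.single i (1 : ℝ)),
      fun i => ?_, fun i => ?_, fun g hg => ?_⟩
    · exact Finset.mem_union_left _ (Finset.mem_image_of_mem _ (Finset.mem_univ i))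
    · exact Finset.mem_union_right _ (Finset.mem_image_of_mem _ (Finset.mem_univ i))
    · simp only [Finset.mem_union, Finset.mem_image, Finset.mem_univ, true_and] at hg
      rcases hg with ⟨i, rfl⟩ | ⟨i, rfl⟩
      · rw [norm_smul_single, abs_of_pos hL0]
      · rw [norm_smul_single, abs_neg, abs_of_pos hL0]
  refine ⟨Γ, fun g hg p hp => lt_dist_of_norm_eq (hnorm g hg) (hPM p hp) hLR, fun p hp => ?_⟩
  -- interior: the ball `B(0, M + 1)` sits inside the hull and contains `P`
  have hPΓ : (↑Γ : Set (EuclideanSpace ℝ (Fin 3))) ⊆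
      (↑(P ∪ Γ) : Set (EuclideanSpace ℝ (Fin 3))) := by
    rw [Finset.coe_union]
    exact Set.subset_union_right
  have hball : ball (0 : EuclideanSpace ℝ (Fin 3)) (M + 1) ⊆
      convexHull ℝ (↑(P ∪ Γ) : Set (EuclideanSpace ℝ (Fin 3))) :=
    ball_subset_of_convex _ (convex_convexHull ℝ _) hL3 hL0
      (fun i => subset_convexHull ℝ _ (hPΓ (Finset.mem_coe.2 (hplus i))))
      (fun i => subset_convexHull ℝ _ (hPΓ (Finset.mem_coe.2 (hminus i))))
  refine interior_maximal hball isOpen_ball ?_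
  rw [mem_ball_zero_iff]
  have := hPM p (Finset.mem_coe.1 hp)
  linarith

end Summit.AtomisticToContinuum.Crystallization.Theorems.ParFiveRecountGhostFrame

end
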